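import Literature.AlgebraicGeometry.Motives.PoincareUniversal.KodairaSpencerInjective
import Literature.AlgebraicGeometry.Motives.PoincareUniversal.DualNumberRigidTranslate
import HarnessLib

/-!
# The Kodaira–Spencer class of the Mumford family along a tangent vector is the Kodaira–Spencer class of the
# Poincaré sheaf along `dφ_Θ` of that vector (Atiyah/KS compatibility at a polarisation)

Layer `Literature/AlgebraicGeometry/Motives/PoincareUniversal`, namespaces
`Literature.AlgebraicGeometry.Morphisms.CechUnitCocycle` (§0, generic) and
`Literature.AlgebraicGeometry.Motives.AbelianVariety` (§§1–3).  THEOREMS ONLY (no definition, no named fact, no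
instance).  Setting of the M13 node N3 (`PoincareUniversal/DualNumberChartPoints`, `…/KodairaSpencerInjective`): an
abelian variety `A₀` over `ℂ` with ample `Θ`, `Â = A₀.dualOf Θ hΘ`, a module `𝒫` on `A₀ × Â` with
`(1 × φ_Θ)^*𝒫 ≅ Λ(𝒪(Θ))` (the Mumford sheaf `mumfordSheaf A₀ Θ = m^*𝒪(Θ) ⊗ pr₁^*𝒪(Θ)⁻¹ ⊗ pr₂^*𝒪(Θ)⁻¹`), a closed
point `y₀ ∈ Â`, the Artinian chart `Spec 𝒪_{Â,y₀}/𝔪^{m+1}` with augmentation `ρ = ρℂ Â y₀ hy₀ m`, its `ℂ[ε]`-points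
`wε ψ` of chart points `ψ : 𝒪_{Â,y₀}/𝔪^{m+1} → ℂ[ε]`, frames `F` of `𝒫|_{A₀ × Spec 𝒪/𝔪^{m+1}}` on the preimages of a
finite affine cover `V` of `A₀`, their model cocycle `(absModelData …).cocycle F` and its `ℂ`-linear Kodaira–Spencer map
`ksLinear (cocycle F) ρ : DerAt ρ →ₗ[ℂ] Ȟ¹(𝒱, 𝒪_{A₀})` ([GortzWedhorn2023] Prop. 27.122 `Lie(Pic) → R¹f_*𝒪` via `U[ε]`).

[MumfordAV1970] §8 p. 75 / §13 p. 125 («`(1 × φ_L)^*P ≅ Λ(L)`»; «`Λ(L)|_{X × {x}} ≅ T_x^*L ⊗ L⁻¹`»): for a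
`ℂ[ε]`-point `w′` of `A₀` (a tangent vector `v`), `(1 × w′)^*Λ(𝒪(Θ))` on `A₀ × Spec ℂ[ε]` is THE FIRST-ORDER
DEFORMATION «`t_v^*𝒪(Θ) ⊗ 𝒪(Θ)⁻¹`» of `𝒪_{A₀}`, and its class in `Ȟ¹(A₀, 𝒪)` (the Atiyah class of `𝒪(Θ)` contracted
with `v`) is the Kodaira–Spencer class of `𝒫` along the tangent vector `dφ_Θ(v)` of `Â` — because
`(1 × w′)^*Λ(𝒪(Θ)) ≅ (1 × (φ_Θ ∘ w′))^*𝒫`.  This file makes that dictionary importable BY NAME: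

* §0 (generic unit-cocycle calculus over the dual numbers): `UCocycle.ext'`; every lift `ψ : B → A[ε]` of an
  augmentation `ev` is `derivLift ev D` for the unique derivation `D = ε-part ∘ ψ` (`sndComp_mem_derAt`,
  `derivLift_sndComp`, `exists_eq_derivLift`, `derivLift_injective`); **`diffClass_map_constLift_derivLift`** — the
  first-order class of `p.map (ev + εD)` against the constant deformation `p.map ev` is `ksLinear p ev D`
  (named form of the `key` step of ★ `exists_rel_map_constLift_derivLift_of_ksLinear_eq_zero`);
* §1 **`nonempty_pullback_whiskerLeft_mumfordSheaf_iso`** — `(A₀ ◁ w′)^*Λ(𝒪(Θ)) ≅ (A₀ ◁ (w′ ≫ φ_Θ))^*𝒫` for ANY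
  test morphism `w′ : S → A₀` (the sheaf dictionary; previously inline in ★ `poincare_firstOrderRigid`);
* §2 **`exists_derAt_eq_wε_derivLift`** / `derAt_eq_of_wε_derivLift_eq` — every `ℂ[ε]`-point `w` of `Â` centred at
  `y₀` is `wε (derivLift ρ D)` for a UNIQUE `D ∈ DerAt ρ` («`dφ_Θ(v)` as a derivation», for `w = w′ ≫ φ_Θ`);
* §3 **`exists_frames_cocycle_eq_map`** — a module isomorphic to `(A₀ ◁ wε ψ)^*𝒫` carries frames on the preimage
  cover whose model cocycle over `ℂ[ε]` IS `(cocycle F).map ψ`; assembled: **`mumfordFamily_firstOrder_cocycle`**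
  (frames of `(A₀ ◁ w′)^*Λ(𝒪(Θ))` with model cocycle `(cocycle F).map (derivLift ρ D)`, `w′ ≫ φ_Θ = wε (derivLift ρ D)`)
  and **`mumfordFamily_diffClass_eq_ksLinear`** («KS class of `t_v^*𝒪(Θ) ⊗ 𝒪(Θ)⁻¹` = `KS_𝒫(dφ_Θ v)` in
  `Ȟ¹(A₀, 𝒪)»).

Cell `hodgecm-mathlib`, SOCKETS-F §4 (α) node E4-c5 (count-neutral capital; consumer: the E-road's λ-symmetry of
Kodaira–Spencer classes).  Presearch: [MumfordAV1970] §§8, 13 (held); [GortzWedhorn2023] Prop. 27.122; [MilneAV2008]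
I §8; the statement is the standard «`dφ_L = (v ↦ At(L)⌟v)`» (Sernesi, *Deformations of algebraic schemes*, 3.3.9–3.3.11) —
no formal antecedent in the tree (`rg` for a named form: 0 hits; inline `eΛ` in ★ `PoincareFirstOrderRigid`).
HC_CM is proved only modulo the 7 printed citations until rung 0 closes — this file asserts nothing about HC.

## References
* D. Mumford, *Abelian Varieties* (1970), §8 (p. 75), §13 proof of the Theorem (pp. 125–130). [MumfordAV1970]
* U. Görtz, T. Wedhorn, *Algebraic Geometry II* (2023), Prop. 27.122 (`Lie(Pic_{X/S}) ≅ R¹f_*𝒪_X` via `U[ε]`). [GortzWedhorn2023]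
* U. Görtz, T. Wedhorn, *Algebraic Geometry I*, 2nd ed. (2020), (6.3)–(6.4) (tangent vectors as `k[ε]`-points). [GortzWedhorn2020]
* J. S. Milne, *Abelian Varieties* (2008), I §8 (pp. 36–40). [MilneAV2008]
* The Stacks Project, Tag 01J6 (points with values in a local ring), Tag 02KG. [StacksProject]
-/

noncomputable section

universe u v

open TensorProduct CategoryTheory AlgebraicGeometry

/-! ## §0 Generic: lifts of an augmentation over the dual numbers are `derivLift`s; the first-order class of
`p.map (ev + εD)` is `KS_p(D)` -/

namespace Literature.AlgebraicGeometry.Morphisms.CechUnitCocycle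

open Literature.RingTheory.Flat Literature.RingTheory.Flat.IsSmallExtension
open TrivSqZeroExt

section Generic

variable {A : Type u} [CommRing A] {X : Scheme.{u}} {f : X ⟶ Spec (.of A)} {ι : Type v} {U : ι → X.Opens}
  {B : Type u} [CommRing B] [Algebra A B]

/-- Two unit cocycles with the same transition functions are equal. [cite: StacksProject, Tag 02KG] -/
theorem UCocycle.ext' {R : Type u} [CommRing R] [Algebra A R] {u u' : UCocycle f U R}
    (h : ∀ i j, u.val i j = u'.val i j) : u = u' := by
  obtain ⟨v, hv, hc⟩ := u
  obtain ⟨v', hv', hc'⟩ := u'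
  obtain rfl : v = v' := funext fun i => funext fun j => h i j
  rfl

/-- **The `ε`-part of a lift `ψ : B → A[ε]` of `ev` is a derivation at `ev`** (Leibniz rule in `A[ε]`).
[cite: GortzWedhorn2020, (6.3)–(6.4)] -/
theorem sndComp_mem_derAt (ev : B →ₐ[A] A) (ψ : B →ₐ[A] DualNumber A) (hψ : (fstHom A A A).comp ψ = ev) :
    (TrivSqZeroExt.sndHom A A ∘ₗ ψ.toLinearMap) ∈ DerAt ev := by
  subst hψ
  intro b b'
  simp only [LinearMap.coe_comp, Function.comp_apply, AlgHom.toLinearMap_apply, sndHom_apply, map_mul,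
    DualNumber.snd_mul, AlgHom.coe_comp, fstHom_apply]
  ring

/-- **Every lift of `ev` over `A[ε]` is `ev + ε D` with `D` its `ε`-part.** [cite: GortzWedhorn2020, (6.3)–(6.4)] -/
theorem derivLift_sndComp (ev : B →ₐ[A] A) (ψ : B →ₐ[A] DualNumber A) (hψ : (fstHom A A A).comp ψ = ev) :
    derivLift ev _ (sndComp_mem_derAt ev ψ hψ) = ψ := by
  apply AlgHom.ext
  intro b
  subst hψ
  rw [derivLift_apply]
  exact inl_fst_add_inr_snd_eq (ψ b)

/-- Existential form: a lift of `ev` over `A[ε]` is `derivLift ev D` for some tangent vector `D`.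
[cite: GortzWedhorn2020, (6.3)–(6.4)] -/
theorem exists_eq_derivLift (ev : B →ₐ[A] A) (ψ : B →ₐ[A] DualNumber A) (hψ : (fstHom A A A).comp ψ = ev) :
    ∃ D : DerAt ev, ψ = derivLift ev D.1 D.2 :=
  ⟨⟨_, sndComp_mem_derAt ev ψ hψ⟩, (derivLift_sndComp ev ψ hψ).symm⟩

/-- `D ↦ ev + εD` is injective. [cite: GortzWedhorn2020, (6.3)–(6.4)] -/
theorem derivLift_injective (ev : B →ₐ[A] A) (D D' : DerAt ev)
    (h : derivLift ev D.1 D.2 = derivLift ev D'.1 D'.2) : D = D' := by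
  apply Subtype.ext
  apply LinearMap.ext
  intro b
  have hb := congrArg (fun φ : B →ₐ[A] DualNumber A => (φ b).snd) h
  simpa using hb

variable [∀ V : X.Opens, Module.Flat A (Sections f V)]

/-- **The first-order class of `p.map (ev + εD)` against the constant deformation `p.map ev` is `KS_p(D)`**:
the difference class (in the frame `ε` of the kernel of `A[ε] → A`) of the two lifts `constLift ev`,
`derivLift ev D` of `ev` along the dual-number small extension is `ksLinear p ev D`.
[cite: GortzWedhorn2023, Prop. 27.122 (proof, `U[ε]`)] [cite: MumfordAV1970, §13 (proof of the Thm. p. 125)] -/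
theorem diffClass_map_constLift_derivLift (p : UCocycle f U B) (ev : B →ₐ[A] A) (D : DerAt ev) :
    diffClass (dualNumber_isSmallExtension A) (dualNumber_hρ A) (p.map (constLift ev))
        (p.map (derivLift ev D.1 D.2))
        (sameRed_map_map p (constLift ev) (derivLift ev D.1 D.2) (fst_comp_derivLift ev D.1 D.2)) 0 =
      ksLinear p ev D := by
  rw [diffClass_map_map_eq_ksLinear (dualNumber_isSmallExtension A) (dualNumber_hρ A) p (constLift ev)
    (derivLift ev D.1 D.2) (fst_comp_derivLift ev D.1 D.2) 0]
  have key : ∀ (e : B →ₐ[A] A) (_ : e = ev) (D' : B →ₗ[A] A) (hD' : D' ∈ DerAt e) (_ : D' = D.1),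
      ksLinear p e ⟨D', hD'⟩ = ksLinear p ev D := by
    rintro e rfl D' hD' rfl
    rfl
  exact key _ (fst_comp_constLift ev) _ _ (liftDiffCoord_derivLift ev D.1 D.2)

end Generic

end Literature.AlgebraicGeometry.Morphisms.CechUnitCocycle

namespace Literature.AlgebraicGeometry.Motives.AbelianVariety

open CategoryTheory CategoryTheory.Limits AlgebraicGeometry MonoidalCategory CartesianMonoidalCategory IsLocalRing
open Literature.AlgebraicGeometry.AbelianSchemes Literature.AlgebraicGeometry.AbelianVarieties
  Literature.AlgebraicGeometry.Modules Literature.AlgebraicGeometry.Morphisms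
  Literature.AlgebraicGeometry.Morphisms.CechUnitCocycle Literature.AlgebraicGeometry.Motives
open scoped DualNumber
open TrivSqZeroExt (fstHom)

/-! ## §1 The sheaf dictionary `(A₀ ◁ w′)^*Λ(𝒪(Θ)) ≅ (A₀ ◁ (w′ ≫ φ_Θ))^*𝒫` -/

section SheafDictionary

variable (A₀ : AbelianVariety ℂ) {Θ : CartierDivisor A₀.X.left} (hΘ : Θ.IsAmple)
  (P : (A₀.X ⊗ (A₀.dualOf Θ hΘ).X).left.Modules)

/-- **`(A₀ ◁ w′)^*Λ(𝒪(Θ)) ≅ (A₀ ◁ (w′ ≫ φ_Θ))^*𝒫`** for every test morphism `w′ : S → A₀` over `ℂ`, from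
`(1 × φ_Θ)^*𝒫 ≅ Λ(𝒪(Θ))`: the restriction of the Mumford family along `w′` («`t_v^*𝒪(Θ) ⊗ 𝒪(Θ)⁻¹`» for a
`ℂ[ε]`-point) is the restriction of the Poincaré family along `φ_Θ ∘ w′`.
[cite: MumfordAV1970, §8 (p. 75) and §13 (proof of the Thm. p. 125)] [cite: MilneAV2008, I §8 (pp. 36–40)] -/
theorem nonempty_pullback_whiskerLeft_mumfordSheaf_iso
    (eP : Nonempty ((Scheme.Modules.pullback (AbelianVariety.Hom.toSchemeHom (A₀.oneProdPhiTheta hΘ))).obj P ≅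
      mumfordSheaf A₀ Θ))
    {S : SchemeOver ℂ} (w' : S ⟶ A₀.X) :
    Nonempty ((Scheme.Modules.pullback (A₀.X ◁ w').left).obj (mumfordSheaf A₀ Θ) ≅
      (Scheme.Modules.pullback (A₀.X ◁ (w' ≫ (A₀.phiTheta Θ hΘ).hom.hom.hom)).left).obj P) := by
  obtain ⟨e⟩ := eP
  set φ := (A₀.phiTheta Θ hΘ).hom.hom.hom with hφ
  have hcomp : (A₀.X ◁ (w' ≫ φ)).left = (A₀.X ◁ w').left ≫ (A₀.X ◁ φ).left := by
    rw [MonoidalCategory.whiskerLeft_comp, Over.comp_left]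
  have eφ : (Scheme.Modules.pullback (A₀.X ◁ φ).left).obj P ≅ mumfordSheaf A₀ Θ :=
    eqToIso (congrArg (fun k : (A₀.X ⊗ A₀.X).left ⟶ (A₀.X ⊗ (A₀.dualOf Θ hΘ).X).left =>
      (Scheme.Modules.pullback k).obj P) (whiskerLeft_phiTheta_left_eq A₀ hΘ)) ≪≫ e
  exact ⟨((Scheme.Modules.pullback (A₀.X ◁ w').left).mapIso eφ).symm ≪≫
    ((Scheme.Modules.pullbackComp (A₀.X ◁ w').left (A₀.X ◁ φ).left).app P) ≪≫
    eqToIso (congrArg (fun k => (Scheme.Modules.pullback k).obj P) hcomp).symm⟩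

end SheafDictionary

/-! ## §2 `ℂ[ε]`-points of `Â` centred at `y₀` are `wε (ρ + εD)` for a unique tangent vector `D` -/

section ChartPoints

variable (A₀ : AbelianVariety ℂ) {Θ : CartierDivisor A₀.X.left} (hΘ : Θ.IsAmple)
  (y₀ : (A₀.dualOf Θ hΘ).X.left) [LocallyOfFiniteType (A₀.dualOf Θ hΘ).X.hom]
  (hy₀ : IsClosed ({y₀} : Set (A₀.dualOf Θ hΘ).X.left))

/-- Every `ℂ`-algebra chart point `ψ : 𝒪_{Â,y₀}/𝔪^{m+1} → ℂ[ε]` lifts the augmentation `ρ`.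
[cite: GortzWedhorn2023, Lemma 24.72 (p. 409), proof, Step (I)] -/
theorem fstHom_comp_eq_ρℂ (m : ℕ) (ψ : Rt (A₀.dualOf Θ hΘ).X y₀ m →ₐ[ℂ] ℂ[ε]) :
    (fstHom ℂ ℂ ℂ).comp ψ = ρℂ (A₀.dualOf Θ hΘ).X y₀ hy₀ m :=
  algHom_eq_ρℂ (A₀.dualOf Θ hΘ).X y₀ hy₀ m _

/-- **Every `ℂ[ε]`-point `w` of `Â` centred at `y₀` is `wε (derivLift ρ D)` for a tangent vector
`D ∈ DerAt ρ` at the augmentation of the level `𝒪_{Â,y₀}/𝔪^{n+2}`** («`dφ_Θ(v)` as a derivation», applied to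
`w = w′ ≫ φ_Θ`): Artinian factorisation of `w` through `Spec 𝒪_{Â,y₀}/𝔪^{n+2}` (`ε^{n+2} = 0`), whose chart point
lifts `ρ` and is therefore `ρ + ε·(ε-part)`.
[cite: GortzWedhorn2020, (6.3)–(6.4)] [cite: StacksProject, Tag 01J6 (Schemes, Lemma 26.13.1)] -/
theorem exists_derAt_eq_wε_derivLift (n : ℕ) (w : dualNumberOver ⟶ (A₀.dualOf Θ hΘ).X)
    (hw : dualNumberBasePt w = y₀) :
    ∃ D : DerAt (ρℂ (A₀.dualOf Θ hΘ).X y₀ hy₀ (n + 1)),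
      w = wε A₀ hΘ y₀ (n + 1) (derivLift (ρℂ (A₀.dualOf Θ hΘ).X y₀ hy₀ (n + 1)) D.1 D.2) := by
  set ψ : Rt (A₀.dualOf Θ hΘ).X y₀ (n + 1) →ₐ[ℂ] ℂ[ε] :=
    artinianFactor (A₀.dualOf Θ hΘ).X (topPt (A₀.dualOf Θ hΘ).X y₀) w.left hw (Over.w w) (n + 1)
      (maximalIdeal_dualNumber_pow_eq_bot n) with hψ
  obtain ⟨D, hD⟩ := exists_eq_derivLift _ ψ (fstHom_comp_eq_ρℂ A₀ hΘ y₀ hy₀ (n + 1) ψ)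
  refine ⟨D, ?_⟩
  rw [← hD]
  apply Over.OverMorphism.ext
  rw [wε_left, hψ, Spec_map_artinianFactor]

/-- **Uniqueness of the tangent vector**: `wε (ρ + εD) = wε (ρ + εD′)` forces `D = D′` (extensionality of chart
points into `ℂ[ε]`, ★ `algHom_thickRing_ext`, and injectivity of `D ↦ ρ + εD`).
[cite: StacksProject, Tag 01J6 (Schemes, Lemma 26.13.1)] [cite: GortzWedhorn2023, Prop. 27.208 (p. 685)] -/
theorem derAt_eq_of_wε_derivLift_eq (n : ℕ) (D D' : DerAt (ρℂ (A₀.dualOf Θ hΘ).X y₀ hy₀ (n + 1)))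
    (h : wε A₀ hΘ y₀ (n + 1) (derivLift (ρℂ (A₀.dualOf Θ hΘ).X y₀ hy₀ (n + 1)) D.1 D.2) =
      wε A₀ hΘ y₀ (n + 1) (derivLift (ρℂ (A₀.dualOf Θ hΘ).X y₀ hy₀ (n + 1)) D'.1 D'.2)) : D = D' := by
  refine derivLift_injective _ D D' (algHom_thickRing_ext (A₀.dualOf Θ hΘ).X (topPt (A₀.dualOf Θ hΘ).X y₀)
    (n + 1) (maximalIdeal_dualNumber_pow_eq_bot n) _ _ ?_)
  rw [← wε_left, ← wε_left, h]

omit [LocallyOfFiniteType (A₀.dualOf Θ hΘ).X.hom] in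
/-- `wε ψ` is centred at `y₀`. [cite: StacksProject, Tag 01J6 (Schemes, Lemma 26.13.1)] -/
theorem dualNumberBasePt_wε (m : ℕ) (ψ : Rt (A₀.dualOf Θ hΘ).X y₀ m →ₐ[ℂ] ℂ[ε]) :
    dualNumberBasePt (wε A₀ hΘ y₀ m ψ) = y₀ :=
  Spec_map_comp_thickeningPtι_closedPoint (A₀.dualOf Θ hΘ).X (topPt (A₀.dualOf Θ hΘ).X y₀) m ψ.toRingHom

end ChartPoints

/-! ## §3 The model cocycle of `(A₀ ◁ w′)^*Λ(𝒪(Θ))` over `ℂ[ε]` is `(cocycle F).map (ρ + ε dφ_Θ(v))`; its class is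
`KS_𝒫(dφ_Θ(v))` -/

section ClassIdentity

variable (A₀ : AbelianVariety ℂ) {Θ : CartierDivisor A₀.X.left} (hΘ : Θ.IsAmple)
  (P : (A₀.X ⊗ (A₀.dualOf Θ hΘ).X).left.Modules)
  {ι : Type} (V : ι → A₀.X.left.Opens) (hV : ∀ a, IsAffineOpen (V a))
  (y₀ : (A₀.dualOf Θ hΘ).X.left) [LocallyOfFiniteType (A₀.dualOf Θ hΘ).X.hom]
  (hy₀ : IsClosed ({y₀} : Set (A₀.dualOf Θ hΘ).X.left))
  [IsSeparated A₀.X.hom]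

omit [LocallyOfFiniteType (A₀.dualOf Θ hΘ).X.hom] in
/-- **Frames transported from `𝒫|_{A₀ × Spec 𝒪/𝔪^{m+1}}` along the classifying map of a chart point `ψ`**: a
module `M` on `A₀ × Spec ℂ[ε]` isomorphic to `(A₀ ◁ wε ψ)^*𝒫` carries frames on the preimage cover whose model
cocycle over `ℂ[ε]` is `(cocycle F).map ψ` (pull back `F` along `gε ψ`, cast to the preimage cover, transport along
`gε^*(𝒫|) ≅ (A₀ ◁ wε ψ)^*𝒫 ≅ M`). [cite: StacksProject, Tag 02KG] [cite: MumfordAV1970, §13 (proof of the Thm. pp. 125–130)] -/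
theorem exists_frames_cocycle_eq_map (m : ℕ)
    (F : IFrames (PBn A₀ hΘ P y₀ m) (fun a => (pullback.fst A₀.X.hom (sB A₀ hΘ y₀ m)) ⁻¹ᵁ V a))
    (ψ : Rt (A₀.dualOf Θ hΘ).X y₀ m →ₐ[ℂ] ℂ[ε]) {M : (Yε A₀).Modules}
    (e : Nonempty (M ≅ (Scheme.Modules.pullback (A₀.X ◁ wε A₀ hΘ y₀ m ψ).left).obj P)) :
    ∃ G : IFrames M (fun a => (pullback.fst A₀.X.hom dualNumberOver.hom) ⁻¹ᵁ V a),
      (absModelData A₀.X dualNumberOver.hom dualNumberOver_hom V hV).cocycle G =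
        ((absModelData A₀.X (sB A₀ hΘ y₀ m) (thickeningPt_hom_eq (A₀.dualOf Θ hΘ).X y₀ m) V hV).cocycle F).map
          ψ := by
  obtain ⟨e⟩ := e
  have hg := absModelData_hom A₀.X (sB A₀ hΘ y₀ m) (thickeningPt_hom_eq (A₀.dualOf Θ hΘ).X y₀ m)
    dualNumberOver.hom dualNumberOver_hom ψ V hV
  refine ⟨((F.pullback (gε A₀ hΘ y₀ m ψ)).cast (funext hg.preimage)).mapIso
    (pullbackGεIso A₀ hΘ P y₀ m ψ ≪≫ e.symm), UCocycle.ext' fun a b => ?_⟩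
  exact ((absModelData A₀.X dualNumberOver.hom dualNumberOver_hom V hV).cocycle_mapIso _ _ a b).trans
    (hg.cocycle_pullback_cast F a b)

/-- **THE FIRST-ORDER COCYCLE OF THE MUMFORD FAMILY ALONG A TANGENT VECTOR.**  For `𝒫` with
`(1 × φ_Θ)^*𝒫 ≅ Λ(𝒪(Θ))`, frames `F` of `𝒫|_{A₀ × Spec 𝒪_{Â,y₀}/𝔪^{n+2}}` on the preimages of the affine cover
`V`, and a `ℂ[ε]`-point `w′` of `A₀` with `φ_Θ ∘ w′` centred at `y₀`: there is a UNIQUE-UP-TO-§2 tangent vector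
`D ∈ DerAt ρ` of `Â` at `y₀` with `w′ ≫ φ_Θ = wε (ρ + εD)` («`D = dφ_Θ(v)`»), and `(A₀ ◁ w′)^*Λ(𝒪(Θ))`
(«`t_v^*𝒪(Θ) ⊗ 𝒪(Θ)⁻¹` to first order») carries frames on the preimage cover whose model cocycle over `ℂ[ε]` is
`(cocycle F).map (ρ + εD)`. [cite: MumfordAV1970, §8 (p. 75) and §13 (proof of the Thm. pp. 125–130)]
[cite: GortzWedhorn2023, Prop. 27.122] -/
theorem mumfordFamily_firstOrder_cocycle
    (eP : Nonempty ((Scheme.Modules.pullback (AbelianVariety.Hom.toSchemeHom (A₀.oneProdPhiTheta hΘ))).obj P ≅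
      mumfordSheaf A₀ Θ))
    (n : ℕ) (F : IFrames (PBn A₀ hΘ P y₀ (n + 1)) (fun a => (pullback.fst A₀.X.hom (sB A₀ hΘ y₀ (n + 1))) ⁻¹ᵁ V a))
    (w' : dualNumberOver ⟶ A₀.X) (hw' : dualNumberBasePt (w' ≫ (A₀.phiTheta Θ hΘ).hom.hom.hom) = y₀) :
    ∃ D : DerAt (ρℂ (A₀.dualOf Θ hΘ).X y₀ hy₀ (n + 1)),
      w' ≫ (A₀.phiTheta Θ hΘ).hom.hom.hom =
          wε A₀ hΘ y₀ (n + 1) (derivLift (ρℂ (A₀.dualOf Θ hΘ).X y₀ hy₀ (n + 1)) D.1 D.2) ∧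
        ∃ G : IFrames ((Scheme.Modules.pullback (A₀.X ◁ w').left).obj (mumfordSheaf A₀ Θ))
            (fun a => (pullback.fst A₀.X.hom dualNumberOver.hom) ⁻¹ᵁ V a),
          (absModelData A₀.X dualNumberOver.hom dualNumberOver_hom V hV).cocycle G =
            ((absModelData A₀.X (sB A₀ hΘ y₀ (n + 1)) (thickeningPt_hom_eq (A₀.dualOf Θ hΘ).X y₀ (n + 1))
              V hV).cocycle F).map (derivLift (ρℂ (A₀.dualOf Θ hΘ).X y₀ hy₀ (n + 1)) D.1 D.2) := by
  obtain ⟨D, hD⟩ := exists_derAt_eq_wε_derivLift A₀ hΘ y₀ hy₀ n _ hw'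
  refine ⟨D, hD, ?_⟩
  obtain ⟨e⟩ := nonempty_pullback_whiskerLeft_mumfordSheaf_iso A₀ hΘ P eP w'
  have e' : (Scheme.Modules.pullback (A₀.X ◁ (w' ≫ (A₀.phiTheta Θ hΘ).hom.hom.hom)).left).obj P ≅
      (Scheme.Modules.pullback (A₀.X ◁ wε A₀ hΘ y₀ (n + 1)
        (derivLift (ρℂ (A₀.dualOf Θ hΘ).X y₀ hy₀ (n + 1)) D.1 D.2)).left).obj P :=
    eqToIso (congrArg (fun k : dualNumberOver ⟶ (A₀.dualOf Θ hΘ).X =>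
      (Scheme.Modules.pullback (A₀.X ◁ k).left).obj P) hD)
  obtain ⟨G, hG⟩ := exists_frames_cocycle_eq_map A₀ hΘ P V hV y₀ (n + 1) F
    (derivLift (ρℂ (A₀.dualOf Θ hΘ).X y₀ hy₀ (n + 1)) D.1 D.2) ⟨e ≪≫ e'⟩
  exact ⟨G, hG⟩

/-- **E4-c5: «THE KODAIRA–SPENCER CLASS OF `t_v^*𝒪(Θ) ⊗ 𝒪(Θ)⁻¹` IS `KS_𝒫(dφ_Θ(v))` IN `Ȟ¹(A₀, 𝒪)`».**  In the setting
of `mumfordFamily_firstOrder_cocycle`: the tangent vector `D` («`dφ_Θ(v)`») with `w′ ≫ φ_Θ = wε (ρ + εD)` and frames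
`G` of `(A₀ ◁ w′)^*Λ(𝒪(Θ))` whose model cocycle reduces modulo `ε` to that of the constant deformation
`(cocycle F).map ρ` (SameRed), such that the DIFFERENCE CLASS of the two — the class in `Ȟ¹(𝒱, 𝒪_{A₀})` of the
first-order deformation `(A₀ ◁ w′)^*Λ(𝒪(Θ))` of `𝒫_{y₀}` read against the constant one — is
`ksLinear (cocycle F) ρ D`, the Kodaira–Spencer class of `𝒫` along `D`.  (With ★ `ksLinear_injective_of_rigid`,
★ `finrank_derAt_ρℂ` and ★ `finrank_cechH1_structureSheaf_eq_dim`, `KS_𝒫` is the isomorphism `T_{y₀}Â ⥲ Ȟ¹(A₀,𝒪)`.)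
[cite: MumfordAV1970, §8 (p. 75) and §13 (proof of the Thm. pp. 125–130)] [cite: GortzWedhorn2023, Prop. 27.122] -/
theorem mumfordFamily_diffClass_eq_ksLinear
    (eP : Nonempty ((Scheme.Modules.pullback (AbelianVariety.Hom.toSchemeHom (A₀.oneProdPhiTheta hΘ))).obj P ≅
      mumfordSheaf A₀ Θ))
    (n : ℕ) (F : IFrames (PBn A₀ hΘ P y₀ (n + 1)) (fun a => (pullback.fst A₀.X.hom (sB A₀ hΘ y₀ (n + 1))) ⁻¹ᵁ V a))
    (w' : dualNumberOver ⟶ A₀.X) (hw' : dualNumberBasePt (w' ≫ (A₀.phiTheta Θ hΘ).hom.hom.hom) = y₀) :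
    ∃ D : DerAt (ρℂ (A₀.dualOf Θ hΘ).X y₀ hy₀ (n + 1)),
      w' ≫ (A₀.phiTheta Θ hΘ).hom.hom.hom =
          wε A₀ hΘ y₀ (n + 1) (derivLift (ρℂ (A₀.dualOf Θ hΘ).X y₀ hy₀ (n + 1)) D.1 D.2) ∧
        ∃ (G : IFrames ((Scheme.Modules.pullback (A₀.X ◁ w').left).obj (mumfordSheaf A₀ Θ))
            (fun a => (pullback.fst A₀.X.hom dualNumberOver.hom) ⁻¹ᵁ V a))
          (hred : SameRed
            (((absModelData A₀.X (sB A₀ hΘ y₀ (n + 1)) (thickeningPt_hom_eq (A₀.dualOf Θ hΘ).X y₀ (n + 1))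
              V hV).cocycle F).map (constLift (ρℂ (A₀.dualOf Θ hΘ).X y₀ hy₀ (n + 1))))
            ((absModelData A₀.X dualNumberOver.hom dualNumberOver_hom V hV).cocycle G) (fstHom ℂ ℂ ℂ)),
          diffClass (dualNumber_isSmallExtension ℂ) (dualNumber_hρ ℂ) _ _ hred 0 =
            ksLinear ((absModelData A₀.X (sB A₀ hΘ y₀ (n + 1))
              (thickeningPt_hom_eq (A₀.dualOf Θ hΘ).X y₀ (n + 1)) V hV).cocycle F)
              (ρℂ (A₀.dualOf Θ hΘ).X y₀ hy₀ (n + 1)) D := by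
  obtain ⟨D, hD, G, hG⟩ := mumfordFamily_firstOrder_cocycle A₀ hΘ P V hV y₀ hy₀ eP n F w' hw'
  have key : ∀ (p : UCocycle A₀.X.hom V (Rt (A₀.dualOf Θ hΘ).X y₀ (n + 1)))
      (ρ : Rt (A₀.dualOf Θ hΘ).X y₀ (n + 1) →ₐ[ℂ] ℂ) (D : DerAt ρ) (u : UCocycle A₀.X.hom V ℂ[ε])
      (_ : u = p.map (derivLift ρ D.1 D.2)),
      ∃ h : SameRed (p.map (constLift ρ)) u (fstHom ℂ ℂ ℂ),
        diffClass (dualNumber_isSmallExtension ℂ) (dualNumber_hρ ℂ) _ _ h 0 = ksLinear p ρ D := by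
    rintro p ρ D u rfl
    exact ⟨sameRed_map_map p (constLift ρ) (derivLift ρ D.1 D.2) (fst_comp_derivLift ρ D.1 D.2),
      diffClass_map_constLift_derivLift p ρ D⟩
  obtain ⟨hred, hclass⟩ := key _ _ D _ hG
  exact ⟨D, hD, G, hred, hclass⟩

end ClassIdentity

end Literature.AlgebraicGeometry.Motives.AbelianVariety

end
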